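import Summits.AtomisticToContinuum.HydrodynamicLimit.Theses.LambertianContactSwap
import Summits.AtomisticToContinuum.HydrodynamicLimit.Theorems.LambertianContactSwapSwapGapEntropyTransfer
import Summits.AtomisticToContinuum.HydrodynamicLimit.Theorems.JParityClosureParityInBandSmoothTest
import Summits.AtomisticToContinuum.HydrodynamicLimit.Theorems.JParityClosureParityInBandEnergyTight
import Summits.AtomisticToContinuum.HydrodynamicLimit.Theorems.LambertianContactSwapSwapGapEntropyBudgetStatics
import Literature.MathematicalPhysics.KineticTheory.LambertianHardSphereFlow
import Literature.MathematicalPhysics.KineticTheory.HardSphereEulerProofs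
import HarnessLib

/-!
# `SwapGap` (stmt-AtomisticToContinuum-11850), line `Sketch`, stub T13: smooth compactly supported observables suffice

Helper file (`--supports stmt-AtomisticToContinuum-11850`) for the crux
`Summit.AtomisticToContinuum.HydrodynamicLimit.Theses.LambertianContactSwap.SwapGap`, registered stub
`stub_swapGap_of_smoothObservable` (T13, skeleton v11): the smooth-test form of the crux (hypothesis of T1) follows
from its restriction to `C^∞` compactly supported observables `F : ℝ × V3 × ℝ → ℝ`.

Proof: tightness of the field triple through the kinetic energy per particle (uniformly bounded in mean under both
laws) + approximation of `F` by mollification, cutoff and renormalisation (`exists_smooth_compactSupport_near`, on any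
finite-dimensional real normed space); details in the docstring of the stub.

prover-line-stmt-AtomisticToContinuum-11850-c5-0 (wave 7 worker, stub T13), cycle 6.
-/

noncomputable section

open MeasureTheory Filter Set Topology
open scoped ENNReal Convolution

namespace Summit.AtomisticToContinuum.HydrodynamicLimit.Theorems

open Literature.Analysis.FluidPDE Literature.MathematicalPhysics.KineticTheory
open Literature.Analysis.FunctionSpaces
open Summit.AtomisticToContinuum.HydrodynamicLimit.Theses.LambertianContactSwap

namespace SwapGapSmoothObservable

section Approx

variable {E : Type*} [NormedAddCommGroup E] [NormedSpace ℝ E] [FiniteDimensional ℝ E]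

/-- **Mollification of a bounded `1`-Lipschitz function.** On a finite-dimensional real normed space, a
`1`-Lipschitz `F` with `|F| ≤ 1` is uniformly `ε`-close to a `C^∞`, `1`-Lipschitz `G` with `|G| ≤ 1`:
`G := φ ∗ F` for a normed bump `φ` of outer radius `ε`. [folklore] -/
theorem exists_contDiff_lipschitz_near {F : E → ℝ} (hF : LipschitzWith 1 F) (hF1 : ∀ y, |F y| ≤ 1) {ε : ℝ} (hε : 0 < ε) :
    ∃ G : E → ℝ, ContDiff ℝ ((⊤ : ℕ∞) : WithTop ℕ∞) G ∧ LipschitzWith 1 G ∧ (∀ y, |G y| ≤ 1) ∧ ∀ y, |G y - F y| ≤ ε := by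
  borelize E
  set μ : Measure E := Measure.addHaar
  set φ : ContDiffBump (0 : E) := ⟨ε / 2, ε, half_pos hε, half_lt_self hε⟩
  have hFc : Continuous F := hF.continuous
  refine ⟨φ.normed μ ⋆[ContinuousLinearMap.lsmul ℝ ℝ, μ] F, ?_, ?_, ?_, ?_⟩
  · exact φ.hasCompactSupport_normed.contDiff_convolution_left _ φ.contDiff_normed (hFc.locallyIntegrable (μ := μ))
  · refine LipschitzWith.of_dist_le_mul fun x y => ?_
    have hint : ∀ x : E, Integrable (fun s => φ.normed μ s * F (x - s)) μ := fun x =>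
      (φ.continuous_normed.mul (hFc.comp (continuous_const.sub continuous_id))).integrable_of_hasCompactSupport
        ((φ.hasCompactSupport_normed (μ := μ)).mul_right (f' := fun s => F (x - s)))
    rw [NNReal.coe_one, one_mul, dist_eq_norm, convolution_lsmul, convolution_lsmul]
    simp only [smul_eq_mul]
    rw [← integral_sub (hint x) (hint y)]
    refine (norm_integral_le_of_norm_le (φ.integrable_normed.mul_const (dist x y))
      (Eventually.of_forall fun s => ?_)).trans (le_of_eq ?_)
    · rw [← mul_sub, norm_mul, Real.norm_of_nonneg (φ.nonneg_normed s)]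
      refine mul_le_mul_of_nonneg_left ?_ (φ.nonneg_normed s)
      have h := hF.dist_le_mul (x - s) (y - s)
      rwa [NNReal.coe_one, one_mul, dist_sub_right, dist_eq_norm] at h
    · rw [integral_mul_const, φ.integral_normed, one_mul]
  · intro y
    have h := dist_convolution_le (μ := μ) (g := F) (x₀ := y) (z₀ := (0 : ℝ)) zero_le_one φ.support_normed_eq.subset
      φ.nonneg_normed φ.integral_normed hFc.aestronglyMeasurable (fun x _ => by rw [Real.dist_0_eq_abs]; exact hF1 x)
    rwa [Real.dist_0_eq_abs] at h
  · intro y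
    have h := φ.dist_normed_convolution_le (μ := μ) (x₀ := y) (ε := ε) hFc.aestronglyMeasurable (fun x hx => by
      have h := hF.dist_le_mul x y
      rw [NNReal.coe_one, one_mul] at h
      exact h.trans (le_of_lt (Metric.mem_ball.1 hx)))
    rwa [Real.dist_eq] at h

/-- **Smooth cutoffs with small Lipschitz constant.** For `k > 0` and `R₀` there are `R ≥ R₀`, `R > 0` and a `C^∞`
compactly supported `k`-Lipschitz `ψ : E → [0, 1]` with `ψ = 1` on the closed `R`-ball: rescale a fixed bump `ψ₁`
(`= 1` on the unit ball, `C₁`-Lipschitz by `ContDiff.lipschitzWith_of_hasCompactSupport`) to `ψ₁(R⁻¹ •)`, `R ≥ C₁/k`.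
[folklore] -/
theorem exists_smooth_cutoff {k : ℝ} (hk : 0 < k) (R₀ : ℝ) :
    ∃ R : ℝ, R₀ ≤ R ∧ 0 < R ∧ ∃ ψ : E → ℝ, ContDiff ℝ ((⊤ : ℕ∞) : WithTop ℕ∞) ψ ∧ HasCompactSupport ψ ∧
      (∀ x y, |ψ x - ψ y| ≤ k * ‖x - y‖) ∧ (∀ y, 0 ≤ ψ y) ∧ (∀ y, ψ y ≤ 1) ∧ ∀ y, ‖y‖ ≤ R → ψ y = 1 := by
  let ψ₁ : ContDiffBump (0 : E) := ⟨1, 2, one_pos, one_lt_two⟩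
  obtain ⟨C, hC⟩ := ContDiff.lipschitzWith_of_hasCompactSupport ψ₁.hasCompactSupport (ψ₁.contDiff (n := 1)) (by simp)
  set R : ℝ := max (max R₀ 1) (C / k) with hR
  have hRpos : 0 < R := one_pos.trans_le ((le_max_right _ _).trans (le_max_left _ _))
  have hCR : (C : ℝ) * R⁻¹ ≤ k := by
    rw [← div_eq_mul_inv, div_le_iff₀ hRpos]
    have h : (C : ℝ) / k ≤ R := le_max_right _ _
    rw [div_le_iff₀ hk] at h
    linarith [mul_comm R k]
  refine ⟨R, (le_max_left _ _).trans (le_max_left _ _), hRpos, fun y => ψ₁ (R⁻¹ • y),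
    ψ₁.contDiff.comp (contDiff_id.const_smul R⁻¹), ψ₁.hasCompactSupport.comp_smul (inv_ne_zero hRpos.ne'),
    fun x y => ?_, fun y => ψ₁.nonneg, fun y => ψ₁.le_one, fun y hy => ?_⟩
  · have h := hC.dist_le_mul (R⁻¹ • x) (R⁻¹ • y)
    rw [Real.dist_eq, dist_smul₀, dist_eq_norm, Real.norm_of_nonneg (inv_nonneg.2 hRpos.le), ← mul_assoc] at h
    exact h.trans (mul_le_mul_of_nonneg_right hCR (norm_nonneg _))
  · refine ψ₁.one_of_mem_closedBall (mem_closedBall_zero_iff.2 ?_)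
    rw [norm_smul, Real.norm_of_nonneg (inv_nonneg.2 hRpos.le), inv_mul_le_iff₀ hRpos, mul_one]
    exact hy

/-- **Smooth compactly supported approximation of a bounded `1`-Lipschitz observable, with linear slack at
infinity.** For `η, δ > 0` there is a `C^∞`, compactly supported, `1`-Lipschitz `F̃` with `|F̃| ≤ 1` and
`|F y − F̃ y| ≤ η + δ ‖y‖` for all `y`: `F̃ := (ψ_R · (φ_ε ∗ F))/(1 + k)` (mollify, cut off, renormalise;
`ε = k = η/2`, `R ≥ 2/δ`). [folklore] -/
theorem exists_smooth_compactSupport_near {F : E → ℝ} (hF : LipschitzWith 1 F) (hF1 : ∀ y, |F y| ≤ 1)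
    {η δ : ℝ} (hη : 0 < η) (hδ : 0 < δ) :
    ∃ F' : E → ℝ, ContDiff ℝ ((⊤ : ℕ∞) : WithTop ℕ∞) F' ∧ HasCompactSupport F' ∧ LipschitzWith 1 F' ∧
      (∀ y, |F' y| ≤ 1) ∧ ∀ y, |F y - F' y| ≤ η + δ * ‖y‖ := by
  obtain ⟨G, hGs, hGl, hG1, hGF⟩ := exists_contDiff_lipschitz_near hF hF1 (half_pos hη)
  obtain ⟨R, hR₀, hRpos, ψ, hψs, hψc, hψl, hψ0, hψ1, hψR⟩ := exists_smooth_cutoff (E := E) (half_pos hη) (2 / δ)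
  set k : ℝ := η / 2 with hk
  have hk0 : 0 < k := half_pos hη
  have h1k : 0 < 1 + k := by positivity
  have hψa : ∀ x, |ψ x| ≤ 1 := fun x => abs_le.2 ⟨by linarith [hψ0 x], hψ1 x⟩
  have hGxy : ∀ x y, |G x - G y| ≤ ‖x - y‖ := fun x y => by
    have h := hGl.dist_le_mul x y
    rwa [NNReal.coe_one, one_mul, Real.dist_eq, dist_eq_norm] at h
  have hb1 : ∀ y, |(1 + k)⁻¹ * (ψ y * G y)| ≤ 1 := fun y => by
    rw [abs_mul, abs_inv, abs_of_pos h1k, abs_mul, inv_mul_le_iff₀ h1k, mul_one]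
    exact (mul_le_one₀ (hψa y) (abs_nonneg _) (hG1 y)).trans (by linarith)
  refine ⟨fun y => (1 + k)⁻¹ * (ψ y * G y), contDiff_const.mul (hψs.mul hGs), (hψc.mul_right (f' := G)).mul_left, ?_,
    hb1, fun y => ?_⟩
  · refine LipschitzWith.of_dist_le_mul fun x y => ?_
    rw [NNReal.coe_one, one_mul, Real.dist_eq, ← mul_sub, abs_mul, abs_inv, abs_of_pos h1k, dist_eq_norm,
      inv_mul_le_iff₀ h1k]
    calc |ψ x * G x - ψ y * G y| = |ψ x * (G x - G y) + G y * (ψ x - ψ y)| := by ring_nf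
      _ ≤ |ψ x| * |G x - G y| + |G y| * |ψ x - ψ y| := by
          refine (abs_add_le _ _).trans ?_
          rw [abs_mul, abs_mul]
      _ ≤ 1 * ‖x - y‖ + 1 * (k * ‖x - y‖) :=
          add_le_add (mul_le_mul (hψa x) (hGxy x y) (abs_nonneg _) zero_le_one)
            (mul_le_mul (hG1 y) (hψl x y) (abs_nonneg _) zero_le_one)
      _ = (1 + k) * ‖x - y‖ := by ring
  · show |F y - (1 + k)⁻¹ * (ψ y * G y)| ≤ η + δ * ‖y‖
    have h5 : 0 ≤ δ * ‖y‖ := by positivity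
    by_cases hy : ‖y‖ ≤ R
    · rw [hψR y hy, one_mul]
      have h2 : |G y - (1 + k)⁻¹ * G y| ≤ k := by
        have h3 : G y - (1 + k)⁻¹ * G y = k / (1 + k) * G y := by
          field_simp
          ring
        rw [h3, abs_mul, abs_of_nonneg (by positivity : (0 : ℝ) ≤ k / (1 + k))]
        exact (mul_le_mul_of_nonneg_left (hG1 y) (by positivity)).trans
          (by rw [mul_one]; exact div_le_self hk0.le (by linarith))
      linarith [abs_sub_le (F y) (G y) ((1 + k)⁻¹ * G y), abs_sub_comm (G y) (F y), hGF y]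
    · rw [not_le] at hy
      have h2 : 2 ≤ δ * ‖y‖ := by
        have h3 : 2 / δ ≤ ‖y‖ := hR₀.trans hy.le
        rw [div_le_iff₀ hδ] at h3
        linarith [mul_comm δ ‖y‖]
      have hFy := abs_le.1 (hF1 y)
      have hF'y := abs_le.1 (hb1 y)
      rw [abs_le]
      constructor <;> linarith

end Approx

/-- The kinetic energy per particle `e_1(z) = (N+1)⁻¹ · ½ ∑ᵢ ‖vᵢ‖²` lies in `[0, ∞)`: `‖e_1(z)‖ = e_1(z)`. [folklore] -/
theorem norm_empiricalEnergyField_one {N : ℕ} (z : Config (N + 1) (Fin 3) T3) :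
    ‖empiricalEnergyField z (fun _ => (1 : ℝ))‖ = empiricalEnergyField z (fun _ => (1 : ℝ)) := by
  refine Real.norm_of_nonneg ?_
  rw [empiricalEnergyField_one_eq]
  refine mul_nonneg (by positivity) ?_
  unfold configEnergy
  positivity

-- The body of the next proof is adapted from `SwapGapSmoothTest.integrable_energy_of_lintegral_le` in
-- …Theorems.LambertianContactSwapSwapGapStubSwapGapOfSmoothTest (p127615), whose olean is not yet served by the farm.
/-- **Uniform integrability and mean of the kinetic energy per particle under the local Gibbs laws.** For continuous
positive profiles and `σ ≤ 1/2` there is `C` with: for every `N` and every flow, `e_1` is `P_N`-integrable and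
`∫ e_1 dP_N ≤ C` (`exists_lintegral_sum_norm_sq_localGibbsLaw_le`: `∫⁻ ∑ᵢ ‖vᵢ‖² dP_N ≤ 2C (N + 1)`). [folklore] -/
theorem exists_integral_energy_localGibbsLaw_le {a₀ θ₀ : T3 → ℝ} {u₀ : T3 → V3} (ha : Continuous a₀) (hθ : Continuous θ₀)
    (hu : Continuous u₀) (ha0 : ∀ x, 0 < a₀ x) (hθ0 : ∀ x, 0 < θ₀ x) {σ : ℝ} (hσ2 : σ ≤ 1 / 2) :
    ∃ C : ℝ, 0 ≤ C ∧ ∀ (N : ℕ) (Φ : HardSphereFlow (Torus.geometry (Fin 3)) (hsDiameter σ N) (N + 1)),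
      Integrable (fun z => empiricalEnergyField z (fun _ => (1 : ℝ))) (localGibbsLaw σ a₀ u₀ θ₀ N Φ) ∧
        ∫ z, empiricalEnergyField z (fun _ => (1 : ℝ)) ∂(localGibbsLaw σ a₀ u₀ θ₀ N Φ) ≤ C := by
  obtain ⟨C, hC0, hC⟩ := exists_lintegral_sum_norm_sq_localGibbsLaw_le ha hθ hu ha0 hθ0 hσ2
  refine ⟨C / 2, by positivity, fun N Φ => ?_⟩
  have hμ := hC N Φ
  set μ := localGibbsLaw σ a₀ u₀ θ₀ N Φ with hμdef
  set K : Config (N + 1) (Fin 3) T3 → ℝ := fun z => ∑ i, ‖(z i).2‖ ^ 2 with hK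
  have hKm : Measurable K := Finset.measurable_sum _ fun i _ => ((measurable_pi_apply i).snd.norm).pow_const 2
  have hK0 : ∀ z, 0 ≤ K z := fun z => Finset.sum_nonneg fun i _ => by positivity
  have hKint : Integrable K μ :=
    ⟨hKm.aestronglyMeasurable, (hasFiniteIntegral_iff_ofReal (ae_of_all _ hK0)).2 (hμ.trans_lt ENNReal.ofReal_lt_top)⟩
  have hKle : ∫ z, K z ∂μ ≤ C * ((N : ℝ) + 1) := by
    rw [← ENNReal.ofReal_le_ofReal_iff (by positivity), ofReal_integral_eq_lintegral_ofReal hKint (ae_of_all _ hK0)]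
    exact hμ
  have he : (fun z : Config (N + 1) (Fin 3) T3 => empiricalEnergyField z (fun _ => (1 : ℝ))) =
      fun z => (((N + 1 : ℕ) : ℝ))⁻¹ * (2⁻¹ * K z) := by funext z; rw [empiricalEnergyField_one_eq]; rfl
  rw [he]
  refine ⟨(hKint.const_mul _).const_mul _, ?_⟩
  rw [integral_const_mul, integral_const_mul]
  have hN : (0 : ℝ) < ((N + 1 : ℕ) : ℝ) := by positivity
  calc (((N + 1 : ℕ) : ℝ))⁻¹ * (2⁻¹ * ∫ z, K z ∂μ) ≤ (((N + 1 : ℕ) : ℝ))⁻¹ * (2⁻¹ * (C * ((N : ℝ) + 1))) := by gcongr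
    _ = C / 2 := by push_cast; field_simp

/-- **Sup norm of the field triple.** For a test function with `|χ| ≤ B`, the `χ`-tested field triple
`(ρ_χ, m_χ, e_χ)(z) ∈ ℝ × V3 × ℝ` (sup norm) has norm at most `B (1 + e_1(z))` (`empiricalFields_sub_le` against the
zero test function: `|ρ_χ| ≤ B`, `‖m_χ‖ ≤ B (1/2 + e_1)`, `|e_χ| ≤ B e_1`). [folklore] -/
theorem norm_fieldTriple_le {N : ℕ} (z : Config (N + 1) (Fin 3) T3) {χ : T3 → ℝ} {B : ℝ} (hB : ∀ x, |χ x| ≤ B) :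
    ‖(empiricalDensityField z χ, empiricalMomentumField z χ, empiricalEnergyField z χ)‖ ≤
      B * (1 + empiricalEnergyField z (fun _ => (1 : ℝ))) := by
  have hclose : ∀ x, |(0 : ℝ) - χ x| ≤ B := fun x => by rw [zero_sub, abs_neg]; exact hB x
  obtain ⟨h1, h2, h3⟩ := empiricalFields_sub_le z (χ := χ) (ψ := fun _ => (0 : ℝ)) (δ' := B) hclose
  have h0ρ : empiricalDensityField z (fun _ => (0 : ℝ)) = 0 := by simp [empiricalDensityField]
  have h0m : empiricalMomentumField z (fun _ => (0 : ℝ)) = 0 := by simp [empiricalMomentumField]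
  have h0e : empiricalEnergyField z (fun _ => (0 : ℝ)) = 0 := by simp [empiricalEnergyField]
  rw [h0ρ, zero_sub, abs_neg] at h1
  rw [h0m, zero_sub, norm_neg] at h2
  rw [h0e, zero_sub, abs_neg] at h3
  have he : 0 ≤ empiricalEnergyField z (fun _ => (1 : ℝ)) := (norm_nonneg _).trans_eq (norm_empiricalEnergyField_one z)
  have hB0 : 0 ≤ B := (abs_nonneg _).trans (hB 0)
  rw [Prod.norm_def, Prod.norm_def, Real.norm_eq_abs, Real.norm_eq_abs]
  exact max_le (h1.trans (le_mul_of_one_le_right hB0 (by linarith)))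
    (max_le (h2.trans (mul_le_mul_of_nonneg_left (by linarith) hB0)) (h3.trans (mul_le_mul_of_nonneg_left (by linarith) hB0)))

/-- **Both integrals of the crux move by at most `η + δ B_χ (1 + B)` when `F` is replaced by an `F̃` with
`|F − F̃| ≤ η + δ ‖·‖.** On a probability space, for a measurable configuration-valued `w` whose kinetic energy per
particle `e_1 ∘ w` is integrable with mean `≤ B`, continuous `F, F̃` bounded by `1` and a continuous `χ` with
`|χ| ≤ B_χ`: `|∫ F(fld_χ ∘ w) − ∫ F̃(fld_χ ∘ w)| ≤ η + δ B_χ (1 + B)`. [folklore] -/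
theorem abs_integral_sub_le_of_near {Ω : Type*} [MeasurableSpace Ω] (μ : Measure Ω) [IsProbabilityMeasure μ]
    {F F' : ℝ × V3 × ℝ → ℝ} (hF : Continuous F) (hF' : Continuous F') (hF1 : ∀ y, |F y| ≤ 1) (hF'1 : ∀ y, |F' y| ≤ 1)
    {η δ : ℝ} (hδ : 0 ≤ δ) (hnear : ∀ y, |F y - F' y| ≤ η + δ * ‖y‖)
    {N : ℕ} {w : Ω → Config (N + 1) (Fin 3) T3} (hw : Measurable w) {χ : T3 → ℝ} (hχ : Continuous χ) {Bχ : ℝ}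
    (hBχ : ∀ x, |χ x| ≤ Bχ) (he : Integrable (fun ω => empiricalEnergyField (w ω) (fun _ => (1 : ℝ))) μ) {B : ℝ}
    (hB : ∫ ω, empiricalEnergyField (w ω) (fun _ => (1 : ℝ)) ∂μ ≤ B) :
    |(∫ ω, F (empiricalDensityField (w ω) χ, empiricalMomentumField (w ω) χ, empiricalEnergyField (w ω) χ) ∂μ) -
      ∫ ω, F' (empiricalDensityField (w ω) χ, empiricalMomentumField (w ω) χ, empiricalEnergyField (w ω) χ) ∂μ| ≤
      η + δ * Bχ * (1 + B) := by
  have hint : ∀ {F'' : ℝ × V3 × ℝ → ℝ}, Continuous F'' → (∀ y, |F'' y| ≤ 1) → Integrable (fun ω =>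
      F'' (empiricalDensityField (w ω) χ, empiricalMomentumField (w ω) χ, empiricalEnergyField (w ω) χ)) μ :=
    fun hF'' hF''1 => Integrable.of_bound (hF''.measurable.comp ((measurable_fieldTriple hχ).comp hw)).aestronglyMeasurable 1
      (ae_of_all _ fun ω => by rw [Real.norm_eq_abs]; exact hF''1 _)
  have hBχ0 : 0 ≤ Bχ := (abs_nonneg _).trans (hBχ 0)
  have h1e : Integrable (fun ω => 1 + empiricalEnergyField (w ω) (fun _ => (1 : ℝ))) μ := (integrable_const _).add he
  have hgi : Integrable (fun ω => η + δ * Bχ * (1 + empiricalEnergyField (w ω) (fun _ => (1 : ℝ)))) μ :=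
    (integrable_const _).add (h1e.const_mul _)
  rw [← integral_sub (hint hF hF1) (hint hF' hF'1)]
  refine abs_integral_le_integral_abs.trans ?_
  refine (integral_mono_of_nonneg (ae_of_all _ fun ω => abs_nonneg _) hgi (ae_of_all _ fun ω => ?_)).trans ?_
  · refine (hnear _).trans ?_
    dsimp only
    rw [mul_assoc]
    exact add_le_add le_rfl (mul_le_mul_of_nonneg_left (norm_fieldTriple_le (w ω) hBχ) hδ)
  · rw [integral_add (integrable_const _) (h1e.const_mul _), integral_const, probReal_univ, one_smul, integral_const_mul,
      integral_add (integrable_const _) he, integral_const, probReal_univ, one_smul]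
    have hδB : 0 ≤ δ * Bχ := mul_nonneg hδ hBχ0
    gcongr

/-- Elementary bookkeeping: `|a − a'| ≤ B₁` and `|b − b'| ≤ B₂` give `|a − b| ≤ B₁ + B₂ + |a' − b'|`. [folklore] -/
theorem abs_sub_le_of_near {a a' b b' B₁ B₂ : ℝ} (h1 : |a - a'| ≤ B₁) (h2 : |b - b'| ≤ B₂) : |a - b| ≤ B₁ + B₂ + |a' - b'| := by
  linarith [abs_sub_le a a' b, abs_sub_le a' b' b, abs_sub_comm b' b]

end SwapGapSmoothObservable

open SwapGapSmoothObservable in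
/-- **T13 · SMOOTH COMPACTLY SUPPORTED OBSERVABLES SUFFICE** (`stub_swapGap_of_smoothObservable`, registered stub of line
`Sketch` for stmt-AtomisticToContinuum-11850): the smooth-test form of the crux (hypothesis of T1) follows from its
restriction to observables `F : ℝ × V3 × ℝ → ℝ` that are moreover `C^∞` with compact support. Proof: fix smooth `χ`
(`|χ| ≤ B_χ`), a `1`-Lipschitz `F` with `|F| ≤ 1`, `η > 0`, `σ < σ₀ := min (1/2) σ₁`. TIGHTNESS: the field triple has
sup norm `≤ B_χ (1 + e_1)` (`norm_fieldTriple_le`) and `E e_1 ≤ C` uniformly in `N` under both laws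
(`exists_integral_energy_localGibbsLaw_le`; conserved along `Φ` on the conull good set, `empiricalEnergyField_one_flow`,
`localGibbsLaw_compl_good`; non-increasing along `Λ`, `configEnergy_lambertFlow_le`). APPROXIMATION: mollify, cut off and
renormalise (`exists_smooth_compactSupport_near`: `F̃` smooth, compactly supported, `1`-Lipschitz, `|F̃| ≤ 1`,
`|F − F̃| ≤ η/8 + δ ‖·‖`). Hence both integrals move by at most `η/8 + δ B_χ (1 + C) ≤ η/4`, uniformly in `N`
(`abs_integral_sub_le_of_near`), and the hypothesis at `F̃` concludes. [folklore] -/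
theorem stub_swapGap_of_smoothObservable
    (h :
    ∀ (a₀ θ₀ : T3 → ℝ) (u₀ : T3 → V3), Continuous a₀ → Continuous θ₀ → Continuous u₀ →
      (∀ x, 0 < a₀ x) → (∀ x, 0 < θ₀ x) →
      ∃ σ₀ : ℝ, 0 < σ₀ ∧ ∀ σ : ℝ, 0 < σ → σ < σ₀ →
        ∀ (T : ℝ) (ρ θ : ℝ → T3 → ℝ) (u : ℝ → T3 → V3), IsHardSphereEulerSolution σ T ρ u θ →
          ∀ Φ : (N : ℕ) → HardSphereFlow (Torus.geometry (Fin 3)) (hsDiameter σ N) (N + 1),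
            TendstoHydroFieldsAt (fun N => localGibbsLaw σ a₀ u₀ θ₀ N (Φ N)) Φ ρ u θ 0 →
              ∀ t ∈ Set.Ico 0 T, ∀ χ : T3 → ℝ, Literature.Analysis.FunctionSpaces.Torus.IsSmooth χ →
                ∀ F : ℝ × V3 × ℝ → ℝ, ContDiff ℝ ((⊤ : ℕ∞) : WithTop ℕ∞) F → HasCompactSupport F → LipschitzWith 1 F → (∀ y, |F y| ≤ 1) →
                  Tendsto (fun N : ℕ =>
                    (∫ z, F (empiricalDensityField ((Φ N).flow t z) χ,
                        empiricalMomentumField ((Φ N).flow t z) χ,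
                        empiricalEnergyField ((Φ N).flow t z) χ) ∂(localGibbsLaw σ a₀ u₀ θ₀ N (Φ N))) -
                    ∫ p, F (empiricalDensityField
                          (lambertFlow (Torus.geometry (Fin 3)) (hsDiameter σ N) p.2 p.1 t) χ,
                        empiricalMomentumField
                          (lambertFlow (Torus.geometry (Fin 3)) (hsDiameter σ N) p.2 p.1 t) χ,
                        empiricalEnergyField
                          (lambertFlow (Torus.geometry (Fin 3)) (hsDiameter σ N) p.2 p.1 t) χ)
                      ∂((localGibbsLaw σ a₀ u₀ θ₀ N (Φ N)).prod (lambertNoise (Fin 3))))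
                  atTop (𝓝 0)) :
    ∀ (a₀ θ₀ : T3 → ℝ) (u₀ : T3 → V3), Continuous a₀ → Continuous θ₀ → Continuous u₀ →
      (∀ x, 0 < a₀ x) → (∀ x, 0 < θ₀ x) →
      ∃ σ₀ : ℝ, 0 < σ₀ ∧ ∀ σ : ℝ, 0 < σ → σ < σ₀ →
        ∀ (T : ℝ) (ρ θ : ℝ → T3 → ℝ) (u : ℝ → T3 → V3), IsHardSphereEulerSolution σ T ρ u θ →
          ∀ Φ : (N : ℕ) → HardSphereFlow (Torus.geometry (Fin 3)) (hsDiameter σ N) (N + 1),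
            TendstoHydroFieldsAt (fun N => localGibbsLaw σ a₀ u₀ θ₀ N (Φ N)) Φ ρ u θ 0 →
              ∀ t ∈ Set.Ico 0 T, ∀ χ : T3 → ℝ, Literature.Analysis.FunctionSpaces.Torus.IsSmooth χ →
                ∀ F : ℝ × V3 × ℝ → ℝ, LipschitzWith 1 F → (∀ y, |F y| ≤ 1) →
                  Tendsto (fun N : ℕ =>
                    (∫ z, F (empiricalDensityField ((Φ N).flow t z) χ,
                        empiricalMomentumField ((Φ N).flow t z) χ,
                        empiricalEnergyField ((Φ N).flow t z) χ) ∂(localGibbsLaw σ a₀ u₀ θ₀ N (Φ N))) -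
                    ∫ p, F (empiricalDensityField
                          (lambertFlow (Torus.geometry (Fin 3)) (hsDiameter σ N) p.2 p.1 t) χ,
                        empiricalMomentumField
                          (lambertFlow (Torus.geometry (Fin 3)) (hsDiameter σ N) p.2 p.1 t) χ,
                        empiricalEnergyField
                          (lambertFlow (Torus.geometry (Fin 3)) (hsDiameter σ N) p.2 p.1 t) χ)
                      ∂((localGibbsLaw σ a₀ u₀ θ₀ N (Φ N)).prod (lambertNoise (Fin 3))))
                  atTop (𝓝 0) := by
  intro a₀ θ₀ u₀ ha hθ hu ha0 hθ0
  obtain ⟨σ₁, hσ₁, h'⟩ := h a₀ θ₀ u₀ ha hθ hu ha0 hθ0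
  refine ⟨min 2⁻¹ σ₁, lt_min (by norm_num) hσ₁, ?_⟩
  intro σ hσ hσlt T ρ θ u hE Φ h0 t ht χ hχs F hF hF1
  have hσhalf : σ < 2⁻¹ := hσlt.trans_le (min_le_left _ _)
  have hsmooth := h' σ hσ (hσlt.trans_le (min_le_right _ _)) T ρ θ u hE Φ h0 t ht χ hχs
  have hχ : Continuous χ := hχs.continuous
  -- the laws are probability measures
  have hPN : ∀ N, IsProbabilityMeasure (localGibbsLaw σ a₀ u₀ θ₀ N (Φ N)) := fun N =>
    isProbabilityMeasure_localGibbsLaw ha hθ hu ha0 hθ0 (by linarith) N (Φ N)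
  -- uniform bound on the kinetic energy per particle; conservation along `Φ` a.e., non-increase along `Λ`
  obtain ⟨C, hC0, heN'⟩ := exists_integral_energy_localGibbsLaw_le ha hθ hu ha0 hθ0 (σ := σ) (by linarith)
  have heN := fun N => heN' N (Φ N)
  have heflow : ∀ N, (fun z => empiricalEnergyField ((Φ N).flow t z) (fun _ => (1 : ℝ)))
      =ᵐ[localGibbsLaw σ a₀ u₀ θ₀ N (Φ N)] fun z => empiricalEnergyField z (fun _ => (1 : ℝ)) := fun N => by
    filter_upwards [show ∀ᵐ z ∂(localGibbsLaw σ a₀ u₀ θ₀ N (Φ N)), z ∈ (Φ N).good from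
      localGibbsLaw_compl_good σ a₀ θ₀ u₀ N (Φ N)] with z hz
    exact empiricalEnergyField_one_flow (Φ N) hz t
  have heΛ : ∀ (N : ℕ) (p : Config (N + 1) (Fin 3) T3 × (ℕ → EuclideanSpace ℝ (Fin 3))),
      empiricalEnergyField (lambertFlow (Torus.geometry (Fin 3)) (hsDiameter σ N) p.2 p.1 t) (fun _ => (1 : ℝ)) ≤
        empiricalEnergyField p.1 (fun _ => (1 : ℝ)) := fun N p => by
    rw [empiricalEnergyField_one_eq, empiricalEnergyField_one_eq]
    exact mul_le_mul_of_nonneg_left (configEnergy_lambertFlow_le _ _ _) (by positivity)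
  have hΛm : ∀ N, Measurable fun p : Config (N + 1) (Fin 3) T3 × (ℕ → EuclideanSpace ℝ (Fin 3)) =>
      lambertFlow (Torus.geometry (Fin 3)) (hsDiameter σ N) p.2 p.1 t := fun N =>
    measurable_lambertFlow_hsDiameter hσ.le hσhalf N t
  obtain ⟨Bχ, hBχ0, hBχ⟩ := exists_abs_le_of_continuous_T3 hχ
  -- the `η`-argument
  rw [Metric.tendsto_atTop]
  intro η hη
  set X : ℝ := Bχ * (1 + C) with hX
  have hX0 : 0 ≤ X := by positivity
  set δ : ℝ := η / 8 / (X + 1) with hδ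
  have hδpos : 0 < δ := by positivity
  have hδX : δ * X ≤ η / 8 := by
    rw [hδ, div_mul_eq_mul_div, div_le_iff₀ (by positivity : (0 : ℝ) < X + 1)]
    nlinarith
  have hbound : 2 * (η / 8 + δ * Bχ * (1 + C)) ≤ η / 2 := by
    rw [mul_assoc δ, ← hX]
    linarith
  obtain ⟨F', hF's, hF'c, hF'l, hF'1, hnear⟩ := exists_smooth_compactSupport_near hF hF1 (by positivity : (0 : ℝ) < η / 8) hδpos
  have hlim := hsmooth F' hF's hF'c hF'l hF'1
  rw [Metric.tendsto_atTop] at hlim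
  obtain ⟨N₀, hN₀⟩ := hlim (η / 2) (by positivity)
  refine ⟨N₀, fun N hN => ?_⟩
  have h3 := hN₀ N hN
  rw [Real.dist_0_eq_abs] at h3 ⊢
  haveI := hPN N
  -- the deterministic side
  have h1 := abs_integral_sub_le_of_near (localGibbsLaw σ a₀ u₀ θ₀ N (Φ N)) hF.continuous hF'l.continuous hF1 hF'1 hδpos.le
    hnear ((Φ N).measurable_flow t) hχ hBχ ((heN N).1.congr (heflow N).symm)
    ((integral_congr_ae (heflow N)).trans_le (heN N).2)
  -- the Lambertian side
  have hint : Integrable (fun p : Config (N + 1) (Fin 3) T3 × (ℕ → EuclideanSpace ℝ (Fin 3)) =>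
      empiricalEnergyField (lambertFlow (Torus.geometry (Fin 3)) (hsDiameter σ N) p.2 p.1 t) (fun _ => (1 : ℝ)))
      ((localGibbsLaw σ a₀ u₀ θ₀ N (Φ N)).prod (lambertNoise (Fin 3))) :=
    ((heN N).1.comp_fst (lambertNoise (Fin 3))).mono'
      ((measurable_empiricalEnergyField continuous_const).comp (hΛm N)).aestronglyMeasurable
      (ae_of_all _ fun p => by rw [norm_empiricalEnergyField_one]; exact heΛ N p)
  have hB : ∫ p, empiricalEnergyField (lambertFlow (Torus.geometry (Fin 3)) (hsDiameter σ N) p.2 p.1 t) (fun _ => (1 : ℝ))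
      ∂((localGibbsLaw σ a₀ u₀ θ₀ N (Φ N)).prod (lambertNoise (Fin 3))) ≤ C :=
    calc ∫ p, empiricalEnergyField (lambertFlow (Torus.geometry (Fin 3)) (hsDiameter σ N) p.2 p.1 t) (fun _ => (1 : ℝ))
          ∂((localGibbsLaw σ a₀ u₀ θ₀ N (Φ N)).prod (lambertNoise (Fin 3)))
        ≤ ∫ p, empiricalEnergyField p.1 (fun _ => (1 : ℝ)) ∂((localGibbsLaw σ a₀ u₀ θ₀ N (Φ N)).prod (lambertNoise (Fin 3))) :=
          integral_mono hint ((heN N).1.comp_fst _) fun p => heΛ N p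
      _ = ∫ z, empiricalEnergyField z (fun _ => (1 : ℝ)) ∂(localGibbsLaw σ a₀ u₀ θ₀ N (Φ N)) := by
          have h := integral_fun_fst (μ := localGibbsLaw σ a₀ u₀ θ₀ N (Φ N)) (ν := lambertNoise (Fin 3))
            (fun z : Config (N + 1) (Fin 3) T3 => empiricalEnergyField z (fun _ => (1 : ℝ)))
          rw [probReal_univ, one_smul] at h
          exact h
      _ ≤ C := (heN N).2
  have h2 := abs_integral_sub_le_of_near ((localGibbsLaw σ a₀ u₀ θ₀ N (Φ N)).prod (lambertNoise (Fin 3))) hF.continuous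
    hF'l.continuous hF1 hF'1 hδpos.le hnear (hΛm N) hχ hBχ hint hB
  exact (abs_sub_le_of_near h1 h2).trans_lt (by linarith)

end Summit.AtomisticToContinuum.HydrodynamicLimit.Theorems
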